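import Literature.Computability.Complexity.RecursiveOrbitDeciders
import HarnessLib

/-!
# Recursive orbit deciders, II: the big-step semantics of a recursive procedure and ADEQUACY of
# the activation-record stack

Companion of `RecursiveOrbitDeciders.lean` (`RecProc`: an `FP` step function acting on the active
activation record — CONTINUE `00·frame'` / CALL `01·callee` / RETURN `1·value` —, an `FP` `resume`
splicing a returned value into the waiting caller, the explicit stack semantics `RecProc.run`, and
`RecProc.Cert.mem_PSPACE_of_cert`: a local rank/potential certificate puts the decided language in
`PSPACE`). That file bounds SPACE and TIME; this file says WHAT a recursive procedure computes, in
the form consumers want: the textbook big-step ("natural") semantics of the procedure, by rule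
induction, with no stack in sight.

* `RecProc.Returns f v` — the inductive BIG-STEP semantics: the activation record `f` RETURNS the
  value `v`. Three rules: a record whose step is tagged RETURN returns the tagged value; a record
  whose step is CONTINUE returns whatever the updated record returns; a record whose step is a CALL
  returns whatever the resumed record `resume ⟨f, u⟩` returns, `u` being the value the callee returns
  (Homer–Selman: "the procedure … calls itself … On return from this recursive call, execution
  resumes"). `Returns.unique`: the value is determined.
* **`RecProc.returns_of_run_halted`** (ADEQUACY of the stack implementation): if the run of the
  activation-record stack from the root record `init w` has halted (empty stack) at round `k`, then
  its output register holds a value `v` with `Returns (init w) v` — proved through the stack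
  invariant `StackReturns` ("a stack `f₀ :: f₁ :: … :: fₘ` halts with output `o`" unwinds into
  `Returns f₀ v₀`, `Returns (resume ⟨f₁, v₀⟩) v₁`, …, the last value being `o`).
* **`RecProc.Cert.mem_PSPACE_of_returns`**: with a certificate (so the run halts,
  `Cert.run_halts`), if `Returns (init w) v` forces "first bit of `v` = `[w ∈ L]`", then
  `L ∈ PSPACE`. `Cert.exists_returns`: under a certificate the root record returns some value.
* `RecProc.Returns.induct_inv` — rule induction along an invariant of records in which the
  invariance of a resumed caller may use the (already established) property of the value returned
  to it: the pattern by which a consumer proves the SEMANTIC correctness of its procedure while the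
  certificate's own invariant stays a cheap well-formedness predicate.

HONEST FRAMING (val-lit, KV20 M1 programme, brick (P2) layer L1): generic plumbing; by itself it
proves nothing about `kumarVolk2020_cor_1_3` or its hypothesis; `VP ≠ VNP` is NOT proved and
nothing here bears on it.

## References

* S. Homer, A. L. Selman, *Computability and Complexity Theory*, 2nd ed., Springer 2011, Thm. 5.13
  and its proof, p. 97 (a recursive procedure implemented by a stack of activation records; "On
  return from this recursive call …") [HomerSelman2011].
* S. Arora, B. Barak, *Computational Complexity: A Modern Approach*, CUP 2009, Thm. 4.14 (Savitch:
  the same recursive procedure and its stack implementation) [AroraBarakCC2009].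
-/

noncomputable section

namespace Literature.Computability.Complexity

open _root_.Computability Polynomial CodeFP Brick

namespace RecProc

variable (P : RecProc)

/-! ### The big-step semantics -/

/-- **Big-step semantics of a recursive procedure**: `Returns f v` — the activation record `f`
returns the value `v`. RETURN: a record whose step is tagged `1` returns the tagged value;
CONTINUE: a record whose step is tagged `00` returns what the updated record returns; CALL: a
record whose step is tagged `01` returns what the resumed record `resume ⟨f, u⟩` returns, where `u`
is the value returned by the callee. [cite: HomerSelman2011, Thm. 5.13 (proof, p. 97: "calls itself … On return from this recursive call, execution resumes")] -/
inductive Returns : List Bool → List Bool → Prop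
  /-- RETURN step: the record returns the tagged value. -/
  | ret {f : List Bool} (h0 : (P.step f).getD 0 false = true) : Returns f ((P.step f).drop 1)
  /-- CONTINUE step: the record returns what its updated record returns. -/
  | cont {f v : List Bool} (h0 : (P.step f).getD 0 false = false) (h1 : (P.step f).getD 1 false = false)
      (h : Returns ((P.step f).drop 2) v) : Returns f v
  /-- CALL step: the callee returns `u`, the resumed caller returns `v`; so does the record. -/
  | call {f u v : List Bool} (h0 : (P.step f).getD 0 false = false) (h1 : (P.step f).getD 1 false = true)
      (hg : Returns ((P.step f).drop 2) u) (hf : Returns (P.resume (boolPair f u)) v) : Returns f v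

variable {P}

/-- **The returned value is determined** (the big-step semantics is functional). [cite: HomerSelman2011, Thm. 5.13 (proof, p. 97)] -/
theorem Returns.unique {f v v' : List Bool} (h : P.Returns f v) (h' : P.Returns f v') : v = v' := by
  induction h generalizing v' with
  | ret h0 =>
    cases h' with
    | ret _ => rfl
    | cont h0' _ _ => rw [h0] at h0'; exact absurd h0' (by simp)
    | call h0' _ _ _ => rw [h0] at h0'; exact absurd h0' (by simp)
  | cont h0 h1 _ ih =>
    cases h' with
    | ret h0' => rw [h0] at h0'; exact absurd h0' (by simp)
    | cont _ _ h'' => exact ih h''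
    | call _ h1' _ _ => rw [h1] at h1'; exact absurd h1' (by simp)
  | call h0 h1 _ _ ihg ihf =>
    cases h' with
    | ret h0' => rw [h0] at h0'; exact absurd h0' (by simp)
    | cont _ h1' _ => rw [h1] at h1'; exact absurd h1' (by simp)
    | call _ _ hg' hf' =>
      have hu := ihg hg'
      subst hu
      exact ihf hf'

/-- **Rule induction along an invariant.** To prove `Q f v` for every invariant record `f`
returning `v`: RETURN steps of invariant records satisfy `Q`; CONTINUE keeps the invariant and
pulls `Q` back; a CALL from an invariant record pushes an invariant callee, and — knowing the
callee's returned value `u` ALREADY satisfies `Q` — the resumed caller is invariant and `Q` pulls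
back through it. (The certificate's invariant may thus stay a cheap well-formedness predicate
while the semantic invariant lives here.) [cite: HomerSelman2011, Thm. 5.13 (proof, p. 97)] -/
theorem Returns.induct_inv {Inv : List Bool → Prop} {Q : List Bool → List Bool → Prop}
    (hret : ∀ f, Inv f → (P.step f).getD 0 false = true → Q f ((P.step f).drop 1))
    (hcontI : ∀ f, Inv f → (P.step f).getD 0 false = false → (P.step f).getD 1 false = false →
      Inv ((P.step f).drop 2))
    (hcont : ∀ f v, Inv f → (P.step f).getD 0 false = false → (P.step f).getD 1 false = false →
      P.Returns ((P.step f).drop 2) v → Q ((P.step f).drop 2) v → Q f v)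
    (hcallI : ∀ f, Inv f → (P.step f).getD 0 false = false → (P.step f).getD 1 false = true →
      Inv ((P.step f).drop 2))
    (hresI : ∀ f u, Inv f → (P.step f).getD 0 false = false → (P.step f).getD 1 false = true →
      P.Returns ((P.step f).drop 2) u → Q ((P.step f).drop 2) u → Inv (P.resume (boolPair f u)))
    (hcall : ∀ f u v, Inv f → (P.step f).getD 0 false = false → (P.step f).getD 1 false = true →
      P.Returns ((P.step f).drop 2) u → Q ((P.step f).drop 2) u →
      P.Returns (P.resume (boolPair f u)) v → Q (P.resume (boolPair f u)) v → Q f v)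
    {f v : List Bool} (h : P.Returns f v) (hf : Inv f) : Q f v := by
  induction h with
  | ret h0 => exact hret _ hf h0
  | cont h0 h1 h ih => exact hcont _ _ hf h0 h1 h (ih (hcontI _ hf h0 h1))
  | call h0 h1 hg hr ihg ihr =>
    have hQg := ihg (hcallI _ hf h0 h1)
    exact hcall _ _ _ hf h0 h1 hg hQg hr (ihr (hresI _ _ hf h0 h1 hg hQg))

/-! ### Adequacy of the activation-record stack -/

/-- **Stack unwinding**: `StackReturns (f₀ :: f₁ :: … :: fₘ) o` — the active record `f₀` returns
some `v₀`, the waiting caller `f₁` resumed with `v₀` returns some `v₁`, …, and the bottom record,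
resumed with the value of the one above it, returns `o`. [cite: HomerSelman2011, Thm. 5.13 (proof, p. 97)] -/
inductive StackReturns : List (List Bool) → List Bool → Prop
  /-- a lone record returning `v` -/
  | single {f v : List Bool} (h : P.Returns f v) : StackReturns [f] v
  /-- the active record returns `u` and the stack below, its top resumed with `u`, returns `v` -/
  | cons {f g : List Bool} {rest : List (List Bool)} {u v : List Bool} (h : P.Returns f u)
      (hs : StackReturns (P.resume (boolPair g u) :: rest) v) : StackReturns (f :: g :: rest) v

/-- Replacing the active record by one that returns (at least) the same values keeps the unwinding. [folklore] -/
private theorem StackReturns.of_imp {f f' : List Bool} {rest : List (List Bool)} {o : List Bool}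
    (hs : P.StackReturns (f' :: rest) o) (himp : ∀ v, P.Returns f' v → P.Returns f v) :
    P.StackReturns (f :: rest) o := by
  generalize hst : f' :: rest = st at hs
  cases hs with
  | single h =>
    obtain ⟨rfl, rfl⟩ := List.cons.inj hst
    exact StackReturns.single (himp _ h)
  | cons h hs' =>
    obtain ⟨rfl, rfl⟩ := List.cons.inj hst
    exact StackReturns.cons (himp _ h) hs'

/-- A pushed callee unwinds into its caller: if `callee :: f :: rest` unwinds to `o` and `f`'s step
is the call of `callee`, then `f :: rest` unwinds to `o`. [cite: HomerSelman2011, Thm. 5.13 (proof, p. 97)] -/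
private theorem StackReturns.of_call {f : List Bool} {rest : List (List Bool)} {o : List Bool}
    (h0 : (P.step f).getD 0 false = false) (h1 : (P.step f).getD 1 false = true)
    (hs : P.StackReturns ((P.step f).drop 2 :: f :: rest) o) : P.StackReturns (f :: rest) o := by
  generalize hst : (P.step f).drop 2 :: f :: rest = st at hs
  cases hs with
  | single h => exact absurd (List.cons.inj hst).2 (by simp)
  | cons hg hs' =>
    obtain ⟨rfl, h2⟩ := List.cons.inj hst
    obtain ⟨rfl, rfl⟩ := List.cons.inj h2
    exact hs'.of_imp fun v hv => Returns.call h0 h1 hg hv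

/-- A halted configuration stays put under iteration. [folklore] -/
private theorem iterate_next_halted (out : List Bool) (k : ℕ) :
    P.next^[k] (([] : List (List Bool)), out) = ([], out) := by
  induction k with
  | zero => rfl
  | succ k ih => rw [Function.iterate_succ_apply, next_halted, ih]

/-- **Adequacy, stack form**: a nonempty stack that halts within `k` steps unwinds to the final
output. [cite: HomerSelman2011, Thm. 5.13 (proof, p. 97)] -/
theorem stackReturns_of_halted : ∀ (k : ℕ) (st : List (List Bool)) (out : List Bool), st ≠ [] →
    (P.next^[k] (st, out)).1 = [] → P.StackReturns st (P.next^[k] (st, out)).2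
  | 0, st, out, hne, h => absurd h hne
  | k + 1, [], out, hne, _ => absurd rfl hne
  | k + 1, f :: rest, out, _, h => by
    rw [Function.iterate_succ_apply] at h ⊢
    change (P.next^[k] (P.stepTop out f rest)).1 = [] at h
    change P.StackReturns (f :: rest) (P.next^[k] (P.stepTop out f rest)).2
    unfold stepTop at h ⊢
    by_cases h0 : (P.step f).getD 0 false = true
    · -- RETURN
      rw [if_pos h0] at h ⊢
      cases rest with
      | nil =>
        change P.StackReturns [f] (P.next^[k] (([] : List (List Bool)), (P.step f).drop 1)).2
        rw [iterate_next_halted]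
        exact StackReturns.single (Returns.ret h0)
      | cons g rest' =>
        change (P.next^[k] (P.resume (boolPair g ((P.step f).drop 1)) :: rest', out)).1 = [] at h
        change P.StackReturns (f :: g :: rest')
          (P.next^[k] (P.resume (boolPair g ((P.step f).drop 1)) :: rest', out)).2
        exact StackReturns.cons (Returns.ret h0) (stackReturns_of_halted k _ out (by simp) h)
    · have h0' : (P.step f).getD 0 false = false := by simpa using h0
      rw [if_neg h0] at h ⊢
      by_cases h1 : (P.step f).getD 1 false = true
      · -- CALL
        rw [if_pos h1] at h ⊢
        exact StackReturns.of_call h0' h1 (stackReturns_of_halted k _ out (by simp) h)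
      · -- CONTINUE
        have h1' : (P.step f).getD 1 false = false := by simpa using h1
        rw [if_neg h1] at h ⊢
        exact (stackReturns_of_halted k _ out (by simp) h).of_imp fun v hv => Returns.cont h0' h1' hv

variable (P)

/-- **Adequacy**: if the run from the root record has halted at round `k`, the output register holds
THE value returned by the root record in the big-step semantics. [cite: HomerSelman2011, Thm. 5.13 (proof, p. 97)] -/
theorem returns_of_run_halted (w : List Bool) (k : ℕ) (h : (P.run w k).1 = []) :
    P.Returns (P.init w) (P.run w k).2 := by
  have hs := stackReturns_of_halted (P := P) k [P.init w] [] (by simp) h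
  generalize hst : [P.init w] = st at hs
  cases hs with
  | single h' =>
    obtain ⟨rfl, -⟩ := List.cons.inj hst
    exact h'
  | cons _ _ => exact absurd (List.cons.inj hst).2 (by simp)

/-- Conversely, once the root record returns `v` in the big-step semantics, any halted round of the
run shows `v` in the output register. [cite: HomerSelman2011, Thm. 5.13 (proof, p. 97)] -/
theorem run_out_eq_of_returns {w v : List Bool} (hv : P.Returns (P.init w) v) {k : ℕ}
    (h : (P.run w k).1 = []) : (P.run w k).2 = v :=
  (P.returns_of_run_halted w k h).unique hv

namespace Cert

variable {P}
variable (C : Cert P)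

include C in
/-- Under a certificate the root record returns a value (the run halts, `Cert.run_halts`, and
adequacy). [cite: HomerSelman2011, Thm. 5.13 (proof, p. 97)] -/
theorem exists_returns (w : List Bool) : ∃ v, P.Returns (P.init w) v :=
  ⟨_, P.returns_of_run_halted w _ (C.run_halts w le_rfl)⟩

include C in
/-- **A certified recursive procedure decides the language read off its big-step value**: if
whenever the root record returns `v` the first bit of `v` tells membership in `L`, then
`L ∈ PSPACE`. [cite: HomerSelman2011, Thm. 5.13 (proof, p. 97)] [cite: AroraBarakCC2009, Thm. 4.2 and §4.1] -/
theorem mem_PSPACE_of_returns {L : Language Bool}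
    (hL : ∀ w v, P.Returns (P.init w) v → (w ∈ L ↔ v.getD 0 false = true)) : L ∈ PSPACE :=
  C.mem_PSPACE_of_cert fun w k hk => hL w _ (P.returns_of_run_halted w k hk)

end Cert

end RecProc

end Literature.Computability.Complexity
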